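import Mathlib.Analysis.Calculus.ParametricIntervalIntegral
import Mathlib.MeasureTheory.Integral.DominatedConvergence
import Mathlib.Analysis.SpecialFunctions.Integrals.Basic
import Literature.Probability.Percolation.OneArmLSWProofs
import Literature.Probability.Percolation.OneArmMaximumPrinciple
import Literature.Analysis.Complex.ConformalRadius
import HarnessLib

/-!
# The one-arm exponent: LSW Theorem 1.2 from the radial-`SLE₆` PDE facts (Lemmas 2.2–2.3)

Topic `Literature/Probability/Percolation`; family `crit-perc`. This file continues the
bottom-up discharge of the named fact `Literature.Probability.Percolation.oneArm_exponent` (`ArmExponents.lean`;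
Lawler–Schramm–Werner, *One-arm exponent for critical 2D percolation*, Electron. J. Probab. 7
(2002), paper no. 2, Thm. 1.1). `OneArmScalingLimit.lean` reduced `oneArm_exponent` to the
existence of the scaling limit (LSW §2 p. 3; then the named fact
`LawlerSchrammWerner2002_scalingLimit`, since 2026-08-15 an explicit hypothesis) and
**LSW Theorem 1.2** (`LawlerSchrammWerner2002_scalingLimitExponent`); here Theorem 1.2 is in
turn PROVED from the three ingredients of its printed proof (LSW §2, pp. 4–8):

* the probabilistic input, vendored as ONE named fact `LawlerSchrammWerner2002_hittingPDE`:
  the function `h(θ, t) = P[𝔯(θ) ≤ e^{-t}]` of (2.2) (`𝔯(θ)` the conformal radius about `0` of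
  the component of `0` in `𝕌 ∖ Q(θ)`; at `θ = 2π`, `Q(2π) = Q` is the scaling-limit set whose
  law is the weak limit `ν` of `lswLaw`) is smooth on `S = (0, 2π) × (0, ∞)` and satisfies there
  the PDE (2.4) with `κ = 6` (**Lemma 2.2**, proved in print from Smirnov's Theorem 2.1, the
  chordal/radial equivalence of `SLE₆`, the radial Loewner equation (2.5)–(2.6) and Itô's
  formula), the Dirichlet condition **(2.3)** `h(0, t) = lim_{θ↓0} h(θ, t) = 0` (RSW), and the
  Neumann condition **(2.12)** for `h̃(θ, t) = ∫₀¹ h(θ, t + s) ds` at `θ = 2π` (**Lemma 2.3**,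
  proved in print from the a-priori half-plane three-arm estimate (2.13) of Appendix A and
  the harmonic-measure/conformal-radius estimates (2.14)–(2.16));
* **Koebe's one-quarter theorem** (`Literature.Analysis.Complex.KoebeQuarter`, `Literature/Analysis/Complex/
  ConformalRadius.lean`), giving (2.1) `𝔯/4 ≤ dist(0, Q) ≤ 𝔯`
  (`Literature.Analysis.Complex.conformalRadius_le_four_mul_infDist`, `Literature.Analysis.Complex.min_infDist_one_le_conformalRadius`);
* the deterministic maximum-principle comparison **(2.17)**
  (`LawlerSchrammWerner2002_comparison`, `OneArmMaximumPrinciple.lean`, PROVED there).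

What is PROVED here is the remaining glue of the printed proof: "Since `h` is smooth, `h̃`
also satisfies the PDE (2.4)" (p. 6; differentiation under the integral sign,
`hasDerivAt_tildeAvg_param`), the continuity and boundary behaviour of `h̃` on the closed
domain `[0, 2π] × [0, ∞)` needed by the maximum principle (from (2.3), (2.12) and the
`1`-Lipschitz dependence of `h̃` on `t`, `abs_tildeAvg_sub_le`), the passage from `h̃` back to
`h` (`h(t + 1) ≤ h̃(t) ≤ h(t)`, `h` being non-increasing in `t`), and "The theorem now follows
from (2.17), the definition of `h̃` and (2.1)" (p. 8):
`LawlerSchrammWerner2002_thm_1_2_of_hittingPDE : KoebeQuarter →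
LawlerSchrammWerner2002_hittingPDE → LawlerSchrammWerner2002_scalingLimitExponent`, whence
`oneArm_exponent_of_hittingPDE : (∃ ν, Tendsto lswLaw atTop (𝓝 ν)) →
LawlerSchrammWerner2002_hittingPDE → KoebeQuarter → oneArm_exponent`.

After this file the one-arm exponent rests on exactly: the existence of the scaling limit
(Smirnov, Camia–Newman), the radial-`SLE₆` facts LSW Lemma 2.2/(2.3)/Lemma 2.3 about that
limit, and Koebe covering with some constant `c > 0` (`oneArm_exponent_of_koebeCovering`);
the latter is a theorem (`Complex.ball_subset_image_of_injOn`,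
`Literature/Analysis/Complex/KoebeCovering.lean`, constant `1/(128π)`), plugged in by the
def-free sequel `OneArmHittingPDEProofs.lean`. RSW (`tri_rsw_half_holds`), LSW §3, LSW (3.1)
and LSW's proof of Theorem 1.2 from its lemmas are all proved.

## Contents

* `tildeAvg u t = ∫₀¹ u(t + s) ds` and its elementary properties for non-increasing
  `[0, 1]`-valued `u` (bounds, `1`-Lipschitz in `t`, positivity, `u(t+1) ≤ ũ(t) ≤ u(t)`).
* `continuousOn_prod_of_lipschitz` — joint continuity from Lipschitz-in-`t` plus
  continuity-in-`θ`.
* `hasDerivAt_tildeAvg_param`, `hasDerivAt_tildeAvg_shift` — differentiation of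
  `∫₀¹ h(θ, t + s) ds` in `θ` and in `t` under the integral sign (Mathlib's
  `intervalIntegral.hasDerivAt_integral_of_dominated_loc_of_deriv_le`).
* `LawlerSchrammWerner2002_hittingPDE` (named fact) and the theorems above;
  `IsHittingPDEData.measure_bounds` isolates the bounds of Theorem 1.2 with a constant uniform
  over all laws `ν` identified with `h(2π, ·)` (used for subsequential limits in
  `OneArmSubsequentialLimits.lean`).

## References

* G. F. Lawler, O. Schramm, W. Werner, *One-arm exponent for critical 2D percolation*, Electron.
  J. Probab. 7 (2002), no. 2 — Thm. 1.2 (p. 2), §2: (2.1)–(2.3), Lemma 2.2, (2.4) (p. 4),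
  (2.10)–(2.11) (p. 6), Lemma 2.3, (2.12) (p. 6), proof of Thm. 1.2, (2.17) (pp. 7–8)
  [LawlerSchrammWernerEJP2002].
* G. F. Lawler, *Conformally invariant processes in the plane*, AMS (2005), Thm. 3.17
  [Lawler2008].
-/

noncomputable section

open MeasureTheory Filter Topology Metric Set Real intervalIntegral TopologicalSpace
open scoped ENNReal NNReal Interval

namespace Literature.Probability.Percolation

/-! ### Time averages `ũ(t) = ∫₀¹ u(t + s) ds` of non-increasing functions -/

/-- The time average `ũ(t) = ∫₀¹ u(t + s) ds` over a unit window (LSW p. 6: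
`h̃(θ, t) := ∫₀¹ h(θ, t + s) ds`). [cite: LawlerSchrammWernerEJP2002, §2 (p. 6)] -/
def tildeAvg (u : ℝ → ℝ) (t : ℝ) : ℝ := ∫ s in (0 : ℝ)..1, u (t + s)

section TildeAvg

variable {u : ℝ → ℝ}

/-- `ũ(t) = ∫_t^{t+1} u`. [folklore] -/
theorem tildeAvg_eq_integral (u : ℝ → ℝ) (t : ℝ) : tildeAvg u t = ∫ s in t..t + 1, u s := by
  unfold tildeAvg
  rw [intervalIntegral.integral_comp_add_left u t, add_zero]

/-- A non-increasing `u` shifted by `t` is non-increasing. [folklore] -/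
theorem antitone_shift (hu : Antitone u) (t : ℝ) : Antitone fun s => u (t + s) :=
  fun _ _ hab => hu (by linarith)

/-- `ũ(t) ≤ u(t)` for non-increasing `u`. [folklore] -/
theorem tildeAvg_le (hu : Antitone u) (t : ℝ) : tildeAvg u t ≤ u t := by
  unfold tildeAvg
  calc ∫ s in (0 : ℝ)..1, u (t + s) ≤ ∫ _ in (0 : ℝ)..1, u t :=
        intervalIntegral.integral_mono_on zero_le_one (antitone_shift hu t).intervalIntegrable
          intervalIntegrable_const (fun s hs => hu (by linarith [hs.1]))
    _ = u t := by simp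

/-- `u(t + 1) ≤ ũ(t)` for non-increasing `u`. [folklore] -/
theorem le_tildeAvg (hu : Antitone u) (t : ℝ) : u (t + 1) ≤ tildeAvg u t := by
  unfold tildeAvg
  calc u (t + 1) = ∫ _ in (0 : ℝ)..1, u (t + 1) := by simp
    _ ≤ ∫ s in (0 : ℝ)..1, u (t + s) :=
        intervalIntegral.integral_mono_on zero_le_one intervalIntegrable_const
          (antitone_shift hu t).intervalIntegrable (fun s hs => hu (by linarith [hs.2]))

/-- `ũ` is non-increasing if `u` is. [folklore] -/
theorem tildeAvg_antitone (hu : Antitone u) : Antitone (tildeAvg u) := by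
  intro t t' htt'
  unfold tildeAvg
  exact intervalIntegral.integral_mono_on zero_le_one (antitone_shift hu t').intervalIntegrable
    (antitone_shift hu t).intervalIntegrable (fun s _ => hu (by linarith))

/-- `0 ≤ ũ(t)` if `u ≥ 0`. [folklore] -/
theorem tildeAvg_nonneg (h0 : ∀ s, 0 ≤ u s) (t : ℝ) : 0 ≤ tildeAvg u t :=
  intervalIntegral.integral_nonneg zero_le_one fun s _ => h0 (t + s)

/-- `ũ(t) ≤ 1` if `u ≤ 1` is non-increasing. [folklore] -/
theorem tildeAvg_le_one (hu : Antitone u) (h1 : ∀ s, u s ≤ 1) (t : ℝ) : tildeAvg u t ≤ 1 := by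
  unfold tildeAvg
  calc ∫ s in (0 : ℝ)..1, u (t + s) ≤ ∫ _ in (0 : ℝ)..1, (1 : ℝ) :=
        intervalIntegral.integral_mono_on zero_le_one (antitone_shift hu t).intervalIntegrable
          intervalIntegrable_const (fun s _ => h1 (t + s))
    _ = 1 := by simp

/-- `ũ(t) > 0` if `u > 0` on `(t, ∞)` and `u` is non-increasing. [folklore] -/
theorem tildeAvg_pos (hu : Antitone u) {t : ℝ} (hpos : ∀ s, t < s → 0 < u s) : 0 < tildeAvg u t :=
  intervalIntegral.intervalIntegral_pos_of_pos_on (antitone_shift hu t).intervalIntegrable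
    (fun s hs => hpos (t + s) (by linarith [hs.1])) zero_lt_one

/-- An integral of a `[0, 1]`-valued function over `[a, b]`, `a ≤ b`, lies in `[0, b - a]`.
[folklore] -/
theorem integral_mem_Icc_of_mem_Icc (hu : Antitone u) (hb : ∀ s, u s ∈ Icc (0 : ℝ) 1) {a b : ℝ}
    (hab : a ≤ b) : ∫ s in a..b, u s ∈ Icc 0 (b - a) := by
  constructor
  · exact intervalIntegral.integral_nonneg hab fun s _ => (hb s).1
  · calc ∫ s in a..b, u s ≤ ∫ _ in a..b, (1 : ℝ) :=
          intervalIntegral.integral_mono_on hab hu.intervalIntegrable intervalIntegrable_const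
            fun s _ => (hb s).2
      _ = b - a := by simp

/-- **`ũ` is `1`-Lipschitz** for non-increasing `[0, 1]`-valued `u`:
`ũ(t) - ũ(t') = ∫_t^{t'} u - ∫_{t+1}^{t'+1} u`, both integrals in `[0, t' - t]` for `t ≤ t'`.
[folklore] -/
theorem abs_tildeAvg_sub_le (hu : Antitone u) (hb : ∀ s, u s ∈ Icc (0 : ℝ) 1) (t t' : ℝ) :
    |tildeAvg u t - tildeAvg u t'| ≤ |t - t'| := by
  wlog htt' : t ≤ t' generalizing t t'
  · rw [abs_sub_comm, abs_sub_comm t t']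
    exact this t' t (le_of_not_ge htt')
  rw [tildeAvg_eq_integral, tildeAvg_eq_integral,
    intervalIntegral.integral_interval_sub_interval_comm hu.intervalIntegrable
      hu.intervalIntegrable hu.intervalIntegrable]
  have h1 := integral_mem_Icc_of_mem_Icc hu hb htt'
  have h2 := integral_mem_Icc_of_mem_Icc hu hb (by linarith : t + 1 ≤ t' + 1)
  rw [abs_le, abs_of_nonpos (by linarith)]
  constructor <;> linarith [h1.1, h1.2, h2.1, h2.2]

end TildeAvg

/-! ### Joint continuity from Lipschitz-in-`t` and continuity-in-`θ` -/

/-- If `f(θ, ·)` is `1`-Lipschitz for every `θ ∈ A` and `f(·, t)` is continuous on `A` for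
every `t ∈ B`, then `f` is jointly continuous on `A × B`. [folklore] -/
theorem continuousOn_prod_of_lipschitz {f : ℝ → ℝ → ℝ} {A B : Set ℝ}
    (hlip : ∀ θ ∈ A, ∀ t t', |f θ t - f θ t'| ≤ |t - t'|)
    (hcont : ∀ t ∈ B, ContinuousOn (fun θ => f θ t) A) :
    ContinuousOn (fun p : ℝ × ℝ => f p.1 p.2) (A ×ˢ B) := by
  rintro ⟨θ₀, t₀⟩ ⟨hθ₀, ht₀⟩
  rw [Metric.continuousWithinAt_iff]
  intro ε hε
  obtain ⟨δ, hδ, hδε⟩ := Metric.continuousWithinAt_iff.1 (hcont t₀ ht₀ θ₀ hθ₀) (ε / 2)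
    (half_pos hε)
  refine ⟨min δ (ε / 2), lt_min hδ (half_pos hε), ?_⟩
  rintro ⟨θ, t⟩ ⟨hθ, -⟩ hdist
  rw [Prod.dist_eq, max_lt_iff] at hdist
  obtain ⟨hdθ, hdt⟩ := hdist
  have h1 : dist (f θ t₀) (f θ₀ t₀) < ε / 2 := hδε hθ (lt_of_lt_of_le hdθ (min_le_left _ _))
  have h2 : |f θ t - f θ t₀| ≤ |t - t₀| := hlip θ hθ t t₀
  rw [Real.dist_eq] at h1 hdt ⊢
  calc |f θ t - f θ₀ t₀| = |(f θ t - f θ t₀) + (f θ t₀ - f θ₀ t₀)| := by ring_nf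
    _ ≤ |f θ t - f θ t₀| + |f θ t₀ - f θ₀ t₀| := abs_add_le _ _
    _ < ε / 2 + ε / 2 := by
        have : |t - t₀| < ε / 2 := lt_of_lt_of_le hdt (min_le_right _ _)
        linarith
    _ = ε := by ring

/-! ### Differentiation of `∫₀¹ h(θ, t + s) ds` under the integral sign -/

/-- **Differentiation in the parameter.** If, for `x` in a neighbourhood `V` of `x₀`, the
functions `s ↦ F x (t + s)` (`s ∈ [0, 1]`) are measurable, `F x₀ (t + ·)` is integrable,
`x ↦ F x (t + s)` has derivative `F' x (t + s)` on `V`, `F' x₀ (t + ·)` is continuous on `[0, 1]`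
and `|F'| ≤ C` on `V × [t, t + 1]`, then `x ↦ ∫₀¹ F x (t + s) ds` has derivative
`∫₀¹ F' x₀ (t + s) ds` at `x₀` (Mathlib's
`intervalIntegral.hasDerivAt_integral_of_dominated_loc_of_deriv_le`). [folklore] -/
theorem hasDerivAt_tildeAvg_param {F F' : ℝ → ℝ → ℝ} {x₀ t C : ℝ} {V : Set ℝ} (hV : V ∈ 𝓝 x₀)
    (hmeas : ∀ x ∈ V, AEStronglyMeasurable (fun s => F x (t + s)) (volume.restrict (Ι 0 1)))
    (hint : IntervalIntegrable (fun s => F x₀ (t + s)) volume 0 1)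
    (hcont : ContinuousOn (fun s => F' x₀ (t + s)) (Icc 0 1))
    (hbound : ∀ x ∈ V, ∀ s ∈ Icc (0 : ℝ) 1, |F' x (t + s)| ≤ C)
    (hderiv : ∀ x ∈ V, ∀ s ∈ Icc (0 : ℝ) 1, HasDerivAt (fun y => F y (t + s)) (F' x (t + s)) x) :
    HasDerivAt (fun x => tildeAvg (F x) t) (tildeAvg (F' x₀) t) x₀ := by
  have hIoc : Ι (0 : ℝ) 1 = Ioc 0 1 := uIoc_of_le zero_le_one
  have key := intervalIntegral.hasDerivAt_integral_of_dominated_loc_of_deriv_le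
    (μ := volume) (a := 0) (b := 1) (bound := fun _ => C)
    (F := fun x s => F x (t + s)) (F' := fun x s => F' x (t + s)) (x₀ := x₀) hV
    (by filter_upwards [hV] with x hx using hmeas x hx) hint
    (by rw [hIoc]; exact (hcont.mono Ioc_subset_Icc_self).aestronglyMeasurable measurableSet_Ioc)
    (ae_of_all _ fun s hs x hx => by
      rw [hIoc] at hs
      simpa [Real.norm_eq_abs] using hbound x hx s (Ioc_subset_Icc_self hs))
    intervalIntegrable_const
    (ae_of_all _ fun s hs x hx => by
      rw [hIoc] at hs
      exact hderiv x hx s (Ioc_subset_Icc_self hs))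
  exact key.2

/-- **Differentiation in the shift.** If `u` is measurable and integrable on bounded
intervals, has derivative `u'(τ)` at every `τ ∈ [t - ε, t + ε + 1]` (`ε > 0`) with `u'`
continuous there, then `t ↦ ∫₀¹ u(t + s) ds` has derivative `∫₀¹ u'(t + s) ds` at `t`.
[folklore] -/
theorem hasDerivAt_tildeAvg_shift {u u' : ℝ → ℝ} {t ε : ℝ} (hε : 0 < ε)
    (hmeas : Measurable u) (hint : ∀ a b, IntervalIntegrable u volume a b)
    (hcont : ContinuousOn u' (Icc (t - ε) (t + ε + 1)))
    (hderiv : ∀ τ ∈ Icc (t - ε) (t + ε + 1), HasDerivAt u (u' τ) τ) :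
    HasDerivAt (tildeAvg u) (tildeAvg u' t) t := by
  obtain ⟨C, hC⟩ := (isCompact_Icc (a := t - ε) (b := t + ε + 1)).exists_bound_of_continuousOn
    hcont
  have hV : Icc (t - ε) (t + ε) ∈ 𝓝 t := Icc_mem_nhds (by linarith) (by linarith)
  have hIoc : Ι (0 : ℝ) 1 = Ioc 0 1 := uIoc_of_le zero_le_one
  have hcont' : ContinuousOn (fun s => u' (t + s)) (Icc 0 1) :=
    hcont.comp (continuous_const.add continuous_id).continuousOn
      fun s hs => ⟨by linarith [hs.1], by linarith [hs.2]⟩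
  have key := intervalIntegral.hasDerivAt_integral_of_dominated_loc_of_deriv_le
    (μ := volume) (a := 0) (b := 1) (bound := fun _ => C)
    (F := fun x s => u (x + s)) (F' := fun x s => u' (x + s)) (x₀ := t) hV
    (Eventually.of_forall fun x => (hmeas.comp (measurable_const_add x)).aestronglyMeasurable)
    (by simpa using (hint t (t + 1)).comp_add_left t)
    (by rw [hIoc]; exact (hcont'.mono Ioc_subset_Icc_self).aestronglyMeasurable measurableSet_Ioc)
    (ae_of_all _ fun s hs x hx => by
      rw [hIoc] at hs
      have := hC (x + s) ⟨by linarith [hx.1, hs.1], by linarith [hx.2, hs.2]⟩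
      simpa [Real.norm_eq_abs] using this)
    intervalIntegrable_const
    (ae_of_all _ fun s hs x hx => by
      rw [hIoc] at hs
      exact HasDerivAt.comp_add_const x s (hderiv (x + s) ⟨by linarith [hx.1, hs.1],
        by linarith [hx.2, hs.2]⟩))
  exact key.2

/-! ### The named fact: LSW Lemma 2.2, (2.3), Lemma 2.3 -/

/-- **Lawler–Schramm–Werner 2002, §2: the hitting function `h` and its PDE** (named fact
bundling (2.2)–(2.4), (2.3), Lemma 2.2 and Lemma 2.3, pp. 4–6). For the weak limit `ν` of the
laws of `Q_{1/R}` (the scaling limit `Q = Q(2π)`, LSW §2, p. 3: "the limit exists")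
there are functions `h, h_θ, h_θθ, h_t` on `ℝ²` — in the paper `h(θ, t) := P[𝔯(θ) ≤ e^{-t}]`
(2.2), where `Q(θ)`, `θ ∈ [0, 2π]`, is the scaling limit of the union of `A_θ` with the clusters
meeting the arc `A_θ ⊆ ∂𝕌`, `𝔯(θ)` is the conformal radius about `0` of the component `U(θ)`
of `0` in `𝕌 ∖ Q(θ)` (here `Literature.Analysis.Complex.conformalRadius`, see
`Literature/Analysis/Complex/ConformalRadius.lean` for its agreement with `1/ψ'(0)`), and
`h_θ, h_θθ, h_t` are its partial derivatives — such that: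
* (2.2) at `θ = 2π`: `h(2π, t) = ν{K | 𝔯(K) ≤ e^{-t}}` for all `t`;
* by (2.2), `h(θ, ·)` is non-increasing, `[0, 1]`-valued, and positive on `(0, 2π] × ℝ`
  (positivity is used implicitly on p. 8 when the constants `c₁, c₂` are chosen);
* **Lemma 2.2** (p. 4; "The theory of diffusion processes and (2.10), (2.11) imply that
  `h(θ, t)` is smooth in the range `θ ∈ (0, 2π)`, `t > 0`", p. 6): on `S = (0, 2π) × (0, ∞)`,
  `h` has the partial derivatives `h_θ`, `h_θθ = ∂_θ h_θ`, `h_t`, these are continuous on `S`,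
  and the PDE (2.4) holds with `κ = 6`: `(κ/2) h_θθ + cot(θ/2) h_θ - h_t = 0`;
* **(2.3)** (p. 4, from RSW): for `t > 0`, `h(0, t) = lim_{θ ↓ 0} h(θ, t) = 0`;
* **Lemma 2.3** (p. 6, (2.12)): for every `t > 0` the one-sided `θ`-derivative at `2π` of
  `h̃(θ, t) = ∫₀¹ h(θ, t + s) ds` is zero.
The printed proofs use Smirnov's Theorem 2.1, the identification of chordal and radial `SLE₆`
up to the disconnection time [13, Thm. 4.1], the radial Loewner equation (2.5)–(2.6), Itô's
formula, and (for Lemma 2.3) the half-plane three-arm estimate (2.13) proved in Appendix A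
together with (2.14)–(2.16); none of this is in Mathlib.
[cite: LawlerSchrammWernerEJP2002, §2: (2.2)–(2.4), Lemma 2.2 (p. 4), (2.3) (p. 4),
Lemma 2.3 (p. 6)] -/
def LawlerSchrammWerner2002_hittingPDE : Prop :=
  ∀ ν : ProbabilityMeasure (NonemptyCompacts ℂ), Tendsto lswLaw atTop (𝓝 ν) →
    ∃ h hθ hθθ ht : ℝ → ℝ → ℝ,
      (∀ t, h (2 * π) t = (ν : Measure (NonemptyCompacts ℂ)).real
        {K | Literature.Analysis.Complex.conformalRadius (K : Set ℂ) ≤ Real.exp (-t)}) ∧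
      (∀ θ, Antitone (h θ)) ∧
      (∀ θ ∈ Icc 0 (2 * π), ∀ t, h θ t ∈ Icc (0 : ℝ) 1) ∧
      (∀ θ ∈ Ioc 0 (2 * π), ∀ t, 0 < h θ t) ∧
      (∀ θ ∈ Ioo 0 (2 * π), ∀ t ∈ Ioi (0 : ℝ), HasDerivAt (fun x => h x t) (hθ θ t) θ ∧
        HasDerivAt (fun x => hθ x t) (hθθ θ t) θ ∧ HasDerivAt (fun s => h θ s) (ht θ t) t) ∧
      ContinuousOn (fun p : ℝ × ℝ => hθ p.1 p.2) (Ioo 0 (2 * π) ×ˢ Ioi 0) ∧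
      ContinuousOn (fun p : ℝ × ℝ => hθθ p.1 p.2) (Ioo 0 (2 * π) ×ˢ Ioi 0) ∧
      ContinuousOn (fun p : ℝ × ℝ => ht p.1 p.2) (Ioo 0 (2 * π) ×ˢ Ioi 0) ∧
      (∀ θ ∈ Ioo 0 (2 * π), ∀ t ∈ Ioi (0 : ℝ), lswOp 6 θ (hθθ θ t) (hθ θ t) (ht θ t) = 0) ∧
      (∀ t, 0 < t → h 0 t = 0 ∧ Tendsto (fun θ => h θ t) (𝓝[>] 0) (𝓝 0)) ∧
      (∀ t, 0 < t →
        HasDerivWithinAt (fun θ => ∫ s in (0 : ℝ)..1, h θ (t + s)) 0 (Iic (2 * π)) (2 * π))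

/-! ### `h̃` satisfies the hypotheses of the maximum principle -/

section Glue

variable {h hθ hθθ ht : ℝ → ℝ → ℝ}

/-- The data of `LawlerSchrammWerner2002_hittingPDE` for a fixed limit, as a structure of
hypotheses (everything except the identification (2.2) at `θ = 2π`). [folklore] -/
structure IsHittingPDEData (h hθ hθθ ht : ℝ → ℝ → ℝ) : Prop where
  antitone : ∀ θ, Antitone (h θ)
  mem_Icc : ∀ θ ∈ Icc 0 (2 * π), ∀ t, h θ t ∈ Icc (0 : ℝ) 1
  pos : ∀ θ ∈ Ioc 0 (2 * π), ∀ t, 0 < h θ t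
  hasDerivAt : ∀ θ ∈ Ioo 0 (2 * π), ∀ t ∈ Ioi (0 : ℝ), HasDerivAt (fun x => h x t) (hθ θ t) θ ∧
    HasDerivAt (fun x => hθ x t) (hθθ θ t) θ ∧ HasDerivAt (fun s => h θ s) (ht θ t) t
  continuousOn_θ : ContinuousOn (fun p : ℝ × ℝ => hθ p.1 p.2) (Ioo 0 (2 * π) ×ˢ Ioi 0)
  continuousOn_θθ : ContinuousOn (fun p : ℝ × ℝ => hθθ p.1 p.2) (Ioo 0 (2 * π) ×ˢ Ioi 0)
  continuousOn_t : ContinuousOn (fun p : ℝ × ℝ => ht p.1 p.2) (Ioo 0 (2 * π) ×ˢ Ioi 0)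
  pde : ∀ θ ∈ Ioo 0 (2 * π), ∀ t ∈ Ioi (0 : ℝ), lswOp 6 θ (hθθ θ t) (hθ θ t) (ht θ t) = 0
  dirichlet : ∀ t, 0 < t → h 0 t = 0 ∧ Tendsto (fun θ => h θ t) (𝓝[>] 0) (𝓝 0)
  neumann : ∀ t, 0 < t →
    HasDerivWithinAt (fun θ => ∫ s in (0 : ℝ)..1, h θ (t + s)) 0 (Iic (2 * π)) (2 * π)

variable (H : IsHittingPDEData h hθ hθθ ht)
include H

/-- `h̃(θ, t) ∈ [0, 1]` for `θ ∈ [0, 2π]`. [folklore] -/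
theorem IsHittingPDEData.tildeAvg_mem_Icc {θ : ℝ} (hθ' : θ ∈ Icc 0 (2 * π)) (t : ℝ) :
    tildeAvg (h θ) t ∈ Icc (0 : ℝ) 1 :=
  ⟨tildeAvg_nonneg (fun s => (H.mem_Icc θ hθ' s).1) t,
    tildeAvg_le_one (H.antitone θ) (fun s => (H.mem_Icc θ hθ' s).2) t⟩

/-- `h̃(0, t) = 0` for `t > 0` (from (2.3): `h(0, t + s) = 0`). [folklore] -/
theorem IsHittingPDEData.tildeAvg_zero_left {t : ℝ} (ht' : 0 < t) : tildeAvg (h 0) t = 0 := by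
  unfold tildeAvg
  rw [intervalIntegral.integral_congr (g := fun _ => (0 : ℝ)) (fun s hs => ?_)]
  · simp
  · rw [uIcc_of_le zero_le_one] at hs
    exact (H.dirichlet (t + s) (by linarith [hs.1])).1

/-- Continuity of `θ ↦ h̃(θ, t)` on `[0, 2π]` for `t > 0`: at `θ₀ < 2π` by dominated
convergence from the continuity of `h(·, t + s)` (interior: differentiability; at `0`:
(2.3)), at `θ₀ = 2π` from the Neumann differentiability (2.12). [folklore] -/
theorem IsHittingPDEData.continuousOn_tildeAvg {t : ℝ} (ht' : 0 < t) :
    ContinuousOn (fun θ => tildeAvg (h θ) t) (Icc 0 (2 * π)) := by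
  intro θ₀ hθ₀
  rcases hθ₀.2.lt_or_eq with hlt | heq
  · -- dominated convergence
    have hIoc : Ι (0 : ℝ) 1 = Ioc 0 1 := uIoc_of_le zero_le_one
    refine intervalIntegral.continuousWithinAt_of_dominated_interval (bound := fun _ => 1) ?_ ?_
      intervalIntegrable_const ?_
    · exact Eventually.of_forall fun x =>
        ((H.antitone x).measurable.comp (measurable_const_add t)).aestronglyMeasurable
    · filter_upwards [self_mem_nhdsWithin] with x hx
      exact ae_of_all _ fun s _ => by
        rw [Real.norm_eq_abs, abs_le]
        have := H.mem_Icc x hx (t + s)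
        exact ⟨by linarith [this.1], this.2⟩
    · refine ae_of_all _ fun s hs => ?_
      rw [hIoc] at hs
      have hts : 0 < t + s := by linarith [hs.1]
      rcases hθ₀.1.eq_or_lt with h0 | h0
      · -- `θ₀ = 0`: (2.3)
        subst h0
        have hlim := (H.dirichlet (t + s) hts).2
        have hval := (H.dirichlet (t + s) hts).1
        have : ContinuousWithinAt (fun x => h x (t + s)) (Ioi 0) 0 := by
          rw [ContinuousWithinAt, hval]; exact hlim
        exact (continuousWithinAt_Ioi_iff_Ici.1 this).mono Icc_subset_Ici_self
      · exact (H.hasDerivAt θ₀ ⟨h0, hlt⟩ (t + s) hts).1.continuousAt.continuousWithinAt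
  · -- `θ₀ = 2π`: Lemma 2.3
    subst heq
    exact (H.neumann t ht').continuousWithinAt.mono Icc_subset_Iic_self

/-- Continuity of `θ ↦ h̃(θ, 0)` on `[0, 2π]`: uniform limit of `h̃(·, 1/(n+1))`
(`h̃` is `1`-Lipschitz in `t`). [folklore] -/
theorem IsHittingPDEData.continuousOn_tildeAvg_zero :
    ContinuousOn (fun θ => tildeAvg (h θ) 0) (Icc 0 (2 * π)) := by
  have hunif : TendstoUniformlyOn (fun (n : ℕ) θ => tildeAvg (h θ) (1 / ((n : ℝ) + 1)))
      (fun θ => tildeAvg (h θ) 0) atTop (Icc 0 (2 * π)) := by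
    rw [Metric.tendstoUniformlyOn_iff]
    intro ε hε
    obtain ⟨N, hN⟩ := exists_nat_one_div_lt hε
    filter_upwards [eventually_ge_atTop N] with n hn θ hθ'
    rw [Real.dist_eq]
    have hlip := abs_tildeAvg_sub_le (H.antitone θ) (H.mem_Icc θ hθ') 0 (1 / ((n : ℝ) + 1))
    have hn' : (1 : ℝ) / ((n : ℝ) + 1) ≤ 1 / ((N : ℝ) + 1) := by
      apply one_div_le_one_div_of_le (by positivity)
      exact_mod_cast Nat.succ_le_succ hn
    have hpos : (0 : ℝ) < 1 / ((n : ℝ) + 1) := by positivity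
    rw [zero_sub, abs_neg, abs_of_pos hpos] at hlip
    linarith
  exact hunif.continuousOn
    (Eventually.of_forall fun n => H.continuousOn_tildeAvg (by positivity)).frequently

/-- **Continuity of `h̃` on the closed domain `[0, 2π] × [0, ∞)`.** [folklore] -/
theorem IsHittingPDEData.continuousOn_tildeAvg_prod :
    ContinuousOn (fun p : ℝ × ℝ => tildeAvg (h p.1) p.2) (Icc 0 (2 * π) ×ˢ Ici 0) := by
  refine continuousOn_prod_of_lipschitz
    (fun θ hθ' t t' => abs_tildeAvg_sub_le (H.antitone θ) (H.mem_Icc θ hθ') t t') ?_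
  intro t ht'
  rcases (mem_Ici.1 ht').eq_or_lt with h0 | h0
  · rw [← h0]; exact H.continuousOn_tildeAvg_zero
  · exact H.continuousOn_tildeAvg h0

omit H in
/-- A compact neighbourhood of `θ₀ ∈ (0, 2π)` inside `(0, 2π)`. [folklore] -/
theorem exists_Icc_subset_Ioo {θ₀ : ℝ} (hθ₀ : θ₀ ∈ Ioo 0 (2 * π)) :
    ∃ ε, 0 < ε ∧ Icc (θ₀ - ε) (θ₀ + ε) ⊆ Ioo 0 (2 * π) := by
  refine ⟨min θ₀ (2 * π - θ₀) / 2, by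
    have := lt_min hθ₀.1 (sub_pos.2 hθ₀.2); positivity, fun x hx => ⟨?_, ?_⟩⟩
  · have := min_le_left θ₀ (2 * π - θ₀); linarith [hx.1, lt_min hθ₀.1 (sub_pos.2 hθ₀.2)]
  · have := min_le_right θ₀ (2 * π - θ₀); linarith [hx.2, lt_min hθ₀.1 (sub_pos.2 hθ₀.2)]

omit H in
/-- Continuity on `S` of a function gives continuity of `s ↦ F x (t + s)` on `[0, 1]` for
`x ∈ (0, 2π)`, `t > 0`. [folklore] -/
theorem continuousOn_shift_of_continuousOn {F : ℝ → ℝ → ℝ}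
    (hF : ContinuousOn (fun p : ℝ × ℝ => F p.1 p.2) (Ioo 0 (2 * π) ×ˢ Ioi 0)) {x t : ℝ}
    (hx : x ∈ Ioo 0 (2 * π)) (ht' : 0 < t) : ContinuousOn (fun s => F x (t + s)) (Icc 0 1) :=
  hF.comp (continuous_const.prodMk (continuous_const.add continuous_id)).continuousOn
    fun s hs => show (x, t + s) ∈ Ioo 0 (2 * π) ×ˢ Ioi 0 from
      mk_mem_prod hx (mem_Ioi.2 (by linarith [hs.1]))

omit H in
/-- A uniform bound for a function continuous on `S` over `[θ₀ - ε, θ₀ + ε] × [t, t + 1] ⊆ S`.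
[folklore] -/
theorem exists_bound_of_continuousOn {F : ℝ → ℝ → ℝ}
    (hF : ContinuousOn (fun p : ℝ × ℝ => F p.1 p.2) (Ioo 0 (2 * π) ×ˢ Ioi 0)) {θ₀ ε t : ℝ}
    (hε : Icc (θ₀ - ε) (θ₀ + ε) ⊆ Ioo 0 (2 * π)) (ht' : 0 < t) :
    ∃ C, ∀ x ∈ Icc (θ₀ - ε) (θ₀ + ε), ∀ s ∈ Icc (0 : ℝ) 1, |F x (t + s)| ≤ C := by
  have hK : IsCompact (Icc (θ₀ - ε) (θ₀ + ε) ×ˢ Icc t (t + 1)) := isCompact_Icc.prod isCompact_Icc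
  obtain ⟨C, hC⟩ := hK.exists_bound_of_continuousOn
    (hF.mono (prod_mono hε fun τ hτ => lt_of_lt_of_le ht' hτ.1))
  exact ⟨C, fun x hx s hs => by
    simpa [Real.norm_eq_abs] using hC (x, t + s) ⟨hx, by constructor <;> linarith [hs.1, hs.2]⟩⟩

/-- **"Since `h` is smooth, `h̃` also satisfies the PDE"** (LSW p. 6), first `θ`-derivative:
`∂_θ h̃ (θ₀, t) = ∫₀¹ h_θ(θ₀, t + s) ds` on `S`. [cite: LawlerSchrammWernerEJP2002, §2 (p. 6)] -/
theorem IsHittingPDEData.hasDerivAt_tildeAvg_θ {θ₀ t : ℝ} (hθ₀ : θ₀ ∈ Ioo 0 (2 * π))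
    (ht' : 0 < t) :
    HasDerivAt (fun x => tildeAvg (h x) t) (tildeAvg (hθ θ₀) t) θ₀ := by
  obtain ⟨ε, hε, hsub⟩ := exists_Icc_subset_Ioo hθ₀
  obtain ⟨C, hC⟩ := exists_bound_of_continuousOn H.continuousOn_θ hsub ht'
  refine hasDerivAt_tildeAvg_param (V := Icc (θ₀ - ε) (θ₀ + ε)) (C := C)
    (Icc_mem_nhds (by linarith) (by linarith))
    (fun x _ => ((H.antitone x).measurable.comp (measurable_const_add t)).aestronglyMeasurable)
    (antitone_shift (H.antitone θ₀) t).intervalIntegrable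
    (continuousOn_shift_of_continuousOn H.continuousOn_θ hθ₀ ht') hC ?_
  intro x hx s hs
  exact (H.hasDerivAt x (hsub hx) (t + s) (by simp only [mem_Ioi]; linarith [hs.1])).1

/-- Second `θ`-derivative: `∂_θ (∫₀¹ h_θ(·, t + s) ds)(θ₀) = ∫₀¹ h_θθ(θ₀, t + s) ds` on `S`.
[cite: LawlerSchrammWernerEJP2002, §2 (p. 6)] -/
theorem IsHittingPDEData.hasDerivAt_tildeAvg_θθ {θ₀ t : ℝ} (hθ₀ : θ₀ ∈ Ioo 0 (2 * π))
    (ht' : 0 < t) :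
    HasDerivAt (fun x => tildeAvg (hθ x) t) (tildeAvg (hθθ θ₀) t) θ₀ := by
  obtain ⟨ε, hε, hsub⟩ := exists_Icc_subset_Ioo hθ₀
  obtain ⟨C, hC⟩ := exists_bound_of_continuousOn H.continuousOn_θθ hsub ht'
  refine hasDerivAt_tildeAvg_param (V := Icc (θ₀ - ε) (θ₀ + ε)) (C := C)
    (Icc_mem_nhds (by linarith) (by linarith))
    (fun x hx => ((continuousOn_shift_of_continuousOn H.continuousOn_θ (hsub hx) ht').mono
      (by rw [uIoc_of_le zero_le_one]; exact Ioc_subset_Icc_self)).aestronglyMeasurable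
      measurableSet_uIoc)
    ((continuousOn_shift_of_continuousOn H.continuousOn_θ hθ₀ ht').mono
      (by rw [uIcc_of_le zero_le_one])).intervalIntegrable
    (continuousOn_shift_of_continuousOn H.continuousOn_θθ hθ₀ ht') hC ?_
  intro x hx s hs
  exact (H.hasDerivAt x (hsub hx) (t + s) (by simp only [mem_Ioi]; linarith [hs.1])).2.1

/-- `t`-derivative: `∂_t h̃ (θ₀, t) = ∫₀¹ h_t(θ₀, t + s) ds` on `S`.
[cite: LawlerSchrammWernerEJP2002, §2 (p. 6)] -/
theorem IsHittingPDEData.hasDerivAt_tildeAvg_t {θ₀ t : ℝ} (hθ₀ : θ₀ ∈ Ioo 0 (2 * π))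
    (ht' : 0 < t) :
    HasDerivAt (tildeAvg (h θ₀)) (tildeAvg (ht θ₀) t) t := by
  have hε : 0 < t / 2 := half_pos ht'
  have hcont : ContinuousOn (ht θ₀) (Icc (t - t / 2) (t + t / 2 + 1)) :=
    H.continuousOn_t.comp (continuous_const.prodMk continuous_id).continuousOn
      fun τ hτ => show (θ₀, τ) ∈ Ioo 0 (2 * π) ×ˢ Ioi 0 from
        mk_mem_prod hθ₀ (mem_Ioi.2 (by linarith [hτ.1]))
  refine hasDerivAt_tildeAvg_shift hε (H.antitone θ₀).measurable
    (fun a b => (H.antitone θ₀).intervalIntegrable) hcont ?_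
  intro τ hτ
  exact (H.hasDerivAt θ₀ hθ₀ τ (by simp only [mem_Ioi]; linarith [hτ.1])).2.2

/-- **`Λ h̃ = 0` on `S`** (LSW p. 6: "Since `h` is smooth, `h̃` also satisfies the PDE (2.4)"):
`Λ` commutes with the time average by linearity of the integral, `cot(θ/2)` being constant
in `s`. [cite: LawlerSchrammWernerEJP2002, §2 (p. 6)] -/
theorem IsHittingPDEData.lswOp_tildeAvg {θ₀ t : ℝ} (hθ₀ : θ₀ ∈ Ioo 0 (2 * π)) (ht' : 0 < t) :
    lswOp 6 θ₀ (tildeAvg (hθθ θ₀) t) (tildeAvg (hθ θ₀) t) (tildeAvg (ht θ₀) t) = 0 := by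
  have i1 : IntervalIntegrable (fun s => hθθ θ₀ (t + s)) volume 0 1 :=
    ((continuousOn_shift_of_continuousOn H.continuousOn_θθ hθ₀ ht').mono
      (by rw [uIcc_of_le zero_le_one])).intervalIntegrable
  have i2 : IntervalIntegrable (fun s => hθ θ₀ (t + s)) volume 0 1 :=
    ((continuousOn_shift_of_continuousOn H.continuousOn_θ hθ₀ ht').mono
      (by rw [uIcc_of_le zero_le_one])).intervalIntegrable
  have i3 : IntervalIntegrable (fun s => ht θ₀ (t + s)) volume 0 1 :=
    ((continuousOn_shift_of_continuousOn H.continuousOn_t hθ₀ ht').mono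
      (by rw [uIcc_of_le zero_le_one])).intervalIntegrable
  unfold lswOp tildeAvg
  rw [← intervalIntegral.integral_const_mul, ← intervalIntegral.integral_const_mul,
    ← intervalIntegral.integral_add (i1.const_mul _) (i2.const_mul _),
    ← intervalIntegral.integral_sub ((i1.const_mul _).add (i2.const_mul _)) i3]
  rw [intervalIntegral.integral_congr (g := fun _ => (0 : ℝ)) (fun s hs => ?_)]
  · simp
  · rw [uIcc_of_le zero_le_one] at hs
    have := H.pde θ₀ hθ₀ (t + s) (by simp only [mem_Ioi]; linarith [hs.1])
    simpa [lswOp] using this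

/-- **(2.17) for `h̃`**: the maximum-principle comparison applies to `g = h̃` with `κ = 6`,
giving `c e^{-5t/48} sin(θ/4)^{1/3} ≤ h̃(θ, t) ≤ c' e^{-5t/48} sin(θ/4)^{1/3}` for `t ≥ 1`.
[cite: LawlerSchrammWernerEJP2002, (2.17) (p. 7)] -/
theorem IsHittingPDEData.comparison :
    ∃ c c' : ℝ, 0 < c ∧ 0 < c' ∧ ∀ t, 1 ≤ t → ∀ θ ∈ Icc 0 (2 * π),
      c * lswH 6 θ t ≤ tildeAvg (h θ) t ∧ tildeAvg (h θ) t ≤ c' * lswH 6 θ t := by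
  refine LawlerSchrammWerner2002_comparison (κ := 6) (by norm_num)
    (g := fun θ t => tildeAvg (h θ) t) (gθ := fun θ t => tildeAvg (hθ θ) t)
    (gθθ := fun θ t => tildeAvg (hθθ θ) t) (gt := fun θ t => tildeAvg (ht θ) t)
    H.continuousOn_tildeAvg_prod
    (fun θ hθ' t ht' => H.hasDerivAt_tildeAvg_θ hθ' ht')
    (fun θ hθ' t ht' => H.hasDerivAt_tildeAvg_θθ hθ' ht')
    (fun θ hθ' t ht' => H.hasDerivAt_tildeAvg_t hθ' ht')
    (fun θ hθ' t ht' => H.lswOp_tildeAvg hθ' ht')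
    (fun t ht' => H.tildeAvg_zero_left ht')
    (fun t ht' => H.neumann t ht')
    (fun θ hθ' t _ => H.tildeAvg_mem_Icc hθ' t)
    (fun θ hθ' t _ => tildeAvg_pos (H.antitone θ) fun s _ => H.pos θ hθ' s)

/-- **(2.17) for `h` at `θ = 2π`**: `c e^{-5t/48} ≤ h(2π, t)` for `t ≥ 1` and
`h(2π, t) ≤ c' e^{5/48} e^{-5t/48}` for `t ≥ 2` (from `h(t + 1) ≤ h̃(t) ≤ h(t)` and
`H(2π, t) = e^{-5t/48}`). [cite: LawlerSchrammWernerEJP2002, proof of Thm. 1.2 (p. 8)] -/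
theorem IsHittingPDEData.exp_bounds :
    ∃ c c' : ℝ, 0 < c ∧ 0 < c' ∧
      (∀ t, 1 ≤ t → c * Real.exp (-(5 / 48 * t)) ≤ h (2 * π) t) ∧
      (∀ t, 2 ≤ t → h (2 * π) t ≤ c' * Real.exp (-(5 / 48 * t))) := by
  obtain ⟨c, c', hc, hc', hcomp⟩ := H.comparison
  have hπ := Real.pi_pos
  have h2π : (2 * π) ∈ Icc 0 (2 * π) := ⟨by linarith, le_rfl⟩
  have hH : ∀ t, lswH 6 (2 * π) t = Real.exp (-(5 / 48 * t)) := by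
    intro t
    rw [lswH, show 2 * π / 4 = π / 2 by ring, Real.sin_pi_div_two, Real.one_rpow, one_mul,
      lswLambda_six]
  refine ⟨c, c' * Real.exp (5 / 48), hc, by positivity, fun t ht' => ?_, fun t ht' => ?_⟩
  · have := (hcomp t ht' (2 * π) h2π).1
    rw [hH] at this
    exact this.trans (tildeAvg_le (H.antitone _) t)
  · have h1 := (hcomp (t - 1) (by linarith) (2 * π) h2π).2
    rw [hH] at h1
    have h2 : h (2 * π) t ≤ tildeAvg (h (2 * π)) (t - 1) := by
      have := le_tildeAvg (H.antitone (2 * π)) (t - 1)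
      rwa [sub_add_cancel] at this
    calc h (2 * π) t ≤ c' * Real.exp (-(5 / 48 * (t - 1))) := h2.trans h1
      _ = c' * Real.exp (5 / 48) * Real.exp (-(5 / 48 * t)) := by
          rw [mul_assoc, ← Real.exp_add]; ring_nf

end Glue

/-! ### Theorem 1.2 from the PDE facts, Koebe and (2.17) -/

/-- The event `{𝔯(K) ≤ ρ}` is contained in `{dist(0, K) < r}` when `ρ < r` and `ρ < 1`
(`min (dist(0, K)) 1 ≤ 𝔯(K)`, the Schwarz half of (2.1)).
[cite: LawlerSchrammWernerEJP2002, (2.1) (p. 4)] -/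
theorem setOf_conformalRadius_le_subset_meetsBall {ρ r : ℝ} (hρr : ρ < r) (hρ1 : ρ < 1) :
    {K : NonemptyCompacts ℂ | Literature.Analysis.Complex.conformalRadius (K : Set ℂ) ≤ ρ} ⊆ meetsBall r := by
  intro K hK
  rw [mem_setOf_eq] at hK
  rw [mem_meetsBall_iff]
  have hmin := Literature.Analysis.Complex.min_infDist_one_le_conformalRadius (K : Set ℂ)
  have : min (infDist (0 : ℂ) (K : Set ℂ)) 1 < 1 := lt_of_le_of_lt (hmin.trans hK) hρ1
  rw [min_lt_iff, or_iff_left (lt_irrefl _)] at this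
  rw [min_eq_left this.le] at hmin
  linarith

/-- The event `{dist(0, K) < r}` is contained in `{𝔯(K) ≤ c⁻¹ r}` given Koebe covering with
constant `c > 0` (Koebe half of (2.1), there with `c = 1/4`).
[cite: LawlerSchrammWernerEJP2002, (2.1) (p. 4)] -/
theorem meetsBall_subset_setOf_conformalRadius_le {c : ℝ} (hKoebe : Literature.Analysis.Complex.KoebeCovering c)
    (hc : 0 < c) (r : ℝ) :
    meetsBall r ⊆ {K : NonemptyCompacts ℂ | Literature.Analysis.Complex.conformalRadius (K : Set ℂ) ≤ c⁻¹ * r} := by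
  intro K hK
  rw [mem_meetsBall_iff] at hK
  rw [mem_setOf_eq]
  have := Literature.Analysis.Complex.conformalRadius_le_inv_mul_infDist (K := (K : Set ℂ)) hKoebe hc K.nonempty
  have hc' : 0 < c⁻¹ := inv_pos.2 hc
  nlinarith

/-- The event `{dist(0, K) ≤ r}` is contained in `{𝔯(K) ≤ c⁻¹ r}` given Koebe covering with
constant `c > 0` (closed version of the Koebe half of (2.1)).
[cite: LawlerSchrammWernerEJP2002, (2.1) (p. 4)] -/
theorem meetsClosedBall_subset_setOf_conformalRadius_le {c : ℝ} (hKoebe : Literature.Analysis.Complex.KoebeCovering c)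
    (hc : 0 < c) (r : ℝ) :
    meetsClosedBall r ⊆ {K : NonemptyCompacts ℂ | Literature.Analysis.Complex.conformalRadius (K : Set ℂ) ≤ c⁻¹ * r} := by
  intro K hK
  rw [mem_meetsClosedBall_iff] at hK
  rw [mem_setOf_eq]
  exact (Literature.Analysis.Complex.conformalRadius_le_inv_mul_infDist (K := (K : Set ℂ)) hKoebe hc K.nonempty).trans
    (mul_le_mul_of_nonneg_left hK (inv_pos.2 hc).le)

/-- **Uniform two-sided bounds for every law identified with `h(2π, ·)`** (the computation
"The theorem now follows from (2.17), the definition of `h̃` and (2.1)", LSW p. 8, with the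
constant made explicit): given the PDE data `h` and Koebe covering with constant `κ₀ > 0`
(`A = κ₀⁻¹` replacing `4`), there is ONE constant `C > 0` — depending only on `h` (through the
constants of (2.17), `IsHittingPDEData.exp_bounds`) and on `κ₀` — such that every Borel
probability measure `ν` on the Hausdorff space with `ν{𝔯(K) ≤ e^{-t}} = h(2π, t)` for all `t`
satisfies `C⁻¹ r^{5/48} ≤ ν{dist(0, K) < r}` and `ν{dist(0, K) ≤ r} ≤ C r^{5/48}` for
`r ∈ (0, 1/2)`. Lower bound: with `t = 1 - log r ≥ 1`, `{𝔯 ≤ e^{-t} = r/e} ⊆ {dist(0, K) < r}`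
and `h(2π, t) ≥ c e^{-5t/48}`; upper bound: `{dist(0, K) ≤ r} ⊆ {𝔯 ≤ A r = e^{-t}}`,
`t = -log(A r)`, and `h(2π, t) ≤ c' e^{-5t/48}` when `t ≥ 2`, the trivial bound `1` otherwise.
The uniformity in `ν` is what subsequential scaling limits need
(`OneArmSubsequentialLimits.lean`). [cite: LawlerSchrammWernerEJP2002, Thm. 1.2 and its proof (pp. 2, 8)] -/
theorem IsHittingPDEData.measure_bounds {h hθ hθθ ht : ℝ → ℝ → ℝ} (H : IsHittingPDEData h hθ hθθ ht)
    {κ₀ : ℝ} (hKoebe : Literature.Analysis.Complex.KoebeCovering κ₀) (hκ₀ : 0 < κ₀) :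
    ∃ C : ℝ, 0 < C ∧ ∀ ν : ProbabilityMeasure (NonemptyCompacts ℂ),
      (∀ t, h (2 * π) t = (ν : Measure (NonemptyCompacts ℂ)).real
        {K | Literature.Analysis.Complex.conformalRadius (K : Set ℂ) ≤ Real.exp (-t)}) →
      ∀ r : ℝ, 0 < r → r < 1 / 2 →
        C⁻¹ * r ^ (5 / 48 : ℝ) ≤ (ν : Measure (NonemptyCompacts ℂ)).real (meetsBall r) ∧
          (ν : Measure (NonemptyCompacts ℂ)).real (meetsClosedBall r) ≤ C * r ^ (5 / 48 : ℝ) := by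
  have hA : 0 < κ₀⁻¹ := inv_pos.2 hκ₀
  set A : ℝ := κ₀⁻¹ with hA_def
  obtain ⟨c, c', hc, hc', hlow, hup⟩ := H.exp_bounds
  set a : ℝ := 5 / 48 with ha
  -- the constants
  set Cup : ℝ := max (c' * A ^ a) ((A * Real.exp 2) ^ a) with hCup
  set Clow : ℝ := c * Real.exp (-a) with hClow
  have hClow0 : 0 < Clow := by positivity
  have hCup0 : 0 < Cup := lt_max_of_lt_left (by positivity)
  set C : ℝ := max Cup Clow⁻¹ with hC
  have hC0 : 0 < C := lt_max_of_lt_left hCup0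
  refine ⟨C, hC0, fun ν h2π r hr0 hr12 => ⟨?_, ?_⟩⟩
  · -- lower bound
    have hr1 : r < 1 := by linarith
    have hlogr : Real.log r < 0 := Real.log_neg hr0 hr1
    set t : ℝ := 1 - Real.log r with ht_def
    have ht1 : 1 ≤ t := by linarith
    have hexp : Real.exp (-t) = Real.exp (-1) * r := by
      rw [ht_def, show -(1 - Real.log r) = -1 + Real.log r by ring, Real.exp_add, Real.exp_log hr0]
    have hsub : {K : NonemptyCompacts ℂ | Literature.Analysis.Complex.conformalRadius (K : Set ℂ) ≤ Real.exp (-t)} ⊆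
        meetsBall r := by
      refine setOf_conformalRadius_le_subset_meetsBall ?_ ?_
      · rw [hexp]
        have : Real.exp (-1) < 1 := Real.exp_lt_one_iff.2 (by norm_num)
        nlinarith
      · rw [hexp]
        have : Real.exp (-1) < 1 := Real.exp_lt_one_iff.2 (by norm_num)
        nlinarith
    have hmono := measureReal_mono (μ := (ν : Measure (NonemptyCompacts ℂ))) hsub
      (measure_ne_top _ _)
    rw [← h2π t] at hmono
    have hlow' := hlow t ht1
    have hrpow : Real.exp (-(5 / 48 * t)) = Real.exp (-a) * r ^ a := by
      rw [ht_def, ha, Real.rpow_def_of_pos hr0, ← Real.exp_add]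
      ring_nf
    rw [hrpow] at hlow'
    calc C⁻¹ * r ^ a ≤ Clow * r ^ a := by
          apply mul_le_mul_of_nonneg_right _ (Real.rpow_nonneg hr0.le _)
          rw [inv_le_comm₀ hC0 hClow0]
          exact le_max_right _ _
      _ = c * (Real.exp (-a) * r ^ a) := by rw [hClow]; ring
      _ ≤ h (2 * π) t := hlow'
      _ ≤ _ := hmono
  · -- upper bound
    have hsub := meetsClosedBall_subset_setOf_conformalRadius_le hKoebe hκ₀ r
    have h4r : 0 < A * r := mul_pos hA hr0
    set t : ℝ := -Real.log (A * r) with ht_def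
    have hexp : Real.exp (-t) = A * r := by rw [ht_def, neg_neg, Real.exp_log h4r]
    rw [← hexp] at hsub
    have hmono := measureReal_mono (μ := (ν : Measure (NonemptyCompacts ℂ))) hsub
      (measure_ne_top _ _)
    rw [← h2π t] at hmono
    have hra : 0 ≤ r ^ a := Real.rpow_nonneg hr0.le _
    have hCup_le : Cup ≤ C := le_max_left _ _
    rcases le_or_gt 2 t with ht2 | ht2
    · have hup' := hup t ht2
      have hrpow : Real.exp (-(5 / 48 * t)) = A ^ a * r ^ a := by
        rw [ht_def, ha, ← Real.mul_rpow hA.le hr0.le, Real.rpow_def_of_pos h4r]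
        ring_nf
      rw [hrpow] at hup'
      calc (ν : Measure (NonemptyCompacts ℂ)).real (meetsClosedBall r) ≤ h (2 * π) t := hmono
        _ ≤ c' * (A ^ a * r ^ a) := hup'
        _ = (c' * A ^ a) * r ^ a := by ring
        _ ≤ Cup * r ^ a := mul_le_mul_of_nonneg_right (le_max_left _ _) hra
        _ ≤ C * r ^ a := mul_le_mul_of_nonneg_right hCup_le hra
    · -- `t < 2`, i.e. `A r > e^{-2}`: trivial bound
      have hbig : 1 < A * Real.exp 2 * r := by
        have : Real.exp (-2) < A * r := by
          rw [← hexp]; exact Real.exp_lt_exp.2 (by linarith)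
        have e : Real.exp (-2) * Real.exp 2 = 1 := by rw [← Real.exp_add]; simp
        nlinarith [Real.exp_pos 2]
      have hone : 1 ≤ (A * Real.exp 2) ^ a * r ^ a := by
        rw [← Real.mul_rpow (by positivity) hr0.le]
        exact Real.one_le_rpow hbig.le (by norm_num [ha])
      calc (ν : Measure (NonemptyCompacts ℂ)).real (meetsClosedBall r) ≤ 1 :=
            measureReal_le_one
        _ ≤ (A * Real.exp 2) ^ a * r ^ a := hone
        _ ≤ Cup * r ^ a := mul_le_mul_of_nonneg_right (le_max_right _ _) hra
        _ ≤ C * r ^ a := mul_le_mul_of_nonneg_right hCup_le hra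

/-- **LSW Theorem 1.2 from Lemmas 2.2–2.3, Koebe covering and (2.17)** ("The theorem now
follows from (2.17), the definition of `h̃` and (2.1)", p. 8), with Koebe's theorem weakened
to covering with any constant `κ₀ > 0`: for the weak limit `ν`,
`c⁻¹ r^{5/48} ≤ ν{dist(0, K) < r} ≤ c r^{5/48}` for `r ∈ (0, 1/2)`
(`IsHittingPDEData.measure_bounds` and `{dist(0, K) < r} ⊆ {dist(0, K) ≤ r}`).
[cite: LawlerSchrammWernerEJP2002, Thm. 1.2 and its proof (pp. 2, 8)] -/
theorem LawlerSchrammWerner2002_thm_1_2_of_koebeCovering {κ₀ : ℝ} (hKoebe : Literature.Analysis.Complex.KoebeCovering κ₀)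
    (hκ₀ : 0 < κ₀) (hPDE : LawlerSchrammWerner2002_hittingPDE) :
    LawlerSchrammWerner2002_scalingLimitExponent := by
  intro ν hν
  obtain ⟨h, hθ, hθθ, ht, h2π, hanti, hIcc, hpos, hder, hcθ, hcθθ, hct, hpde, hdir, hneu⟩ :=
    hPDE ν hν
  have H : IsHittingPDEData h hθ hθθ ht :=
    ⟨hanti, hIcc, hpos, hder, hcθ, hcθθ, hct, hpde, hdir, hneu⟩
  obtain ⟨C, hC0, hb⟩ := H.measure_bounds hKoebe hκ₀
  refine ⟨C, hC0, fun r hr0 hr12 => ⟨(hb ν h2π r hr0 hr12).1, ?_⟩⟩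
  exact (measureReal_mono (meetsBall_subset_meetsClosedBall r)).trans (hb ν h2π r hr0 hr12).2

/-- **LSW Theorem 1.2 from Lemmas 2.2–2.3, Koebe's one-quarter theorem and (2.17)**, as
printed (Koebe with the sharp constant `1/4`).
[cite: LawlerSchrammWernerEJP2002, Thm. 1.2 and its proof (pp. 2, 8)] -/
theorem LawlerSchrammWerner2002_thm_1_2_of_hittingPDE (hKoebe : Literature.Analysis.Complex.KoebeQuarter)
    (hPDE : LawlerSchrammWerner2002_hittingPDE) : LawlerSchrammWerner2002_scalingLimitExponent :=
  LawlerSchrammWerner2002_thm_1_2_of_koebeCovering hKoebe.koebeCovering (by norm_num) hPDE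

/-- The one-arm exponent from the scaling limit, the radial-`SLE₆` PDE facts and Koebe
covering with any constant. [cite: LawlerSchrammWernerEJP2002, Thm. 1.1, Thm. 1.2, §2–§3] -/
theorem oneArm_exponent_of_koebeCovering {κ₀ : ℝ}
    (h₁ : ∃ ν : ProbabilityMeasure (NonemptyCompacts ℂ), Tendsto lswLaw atTop (𝓝 ν))
    (h₂ : LawlerSchrammWerner2002_hittingPDE) (h₃ : Literature.Analysis.Complex.KoebeCovering κ₀) (hκ₀ : 0 < κ₀) :
    oneArm_exponent :=
  oneArm_exponent_of_scalingLimit' h₁ (LawlerSchrammWerner2002_thm_1_2_of_koebeCovering h₃ hκ₀ h₂)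

/-- **The one-arm exponent from the scaling limit, the radial-`SLE₆` PDE facts and Koebe's
theorem**: `P[0 ↔ ∂Λ_n] = n^{-5/48 + o(1)}` (LSW Thm. 1.1) follows from the existence of the
scaling limit (LSW §2 p. 3), LSW Lemma 2.2/(2.3)/Lemma 2.3, and Koebe's one-quarter theorem;
everything else in LSW's proof (the maximum principle (2.17), the passage (2.1) to distances,
(3.1) and §3, RSW) is proved in this library.
[cite: LawlerSchrammWernerEJP2002, Thm. 1.1, Thm. 1.2, §2–§3] -/
theorem oneArm_exponent_of_hittingPDE
    (h₁ : ∃ ν : ProbabilityMeasure (NonemptyCompacts ℂ), Tendsto lswLaw atTop (𝓝 ν))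
    (h₂ : LawlerSchrammWerner2002_hittingPDE) (h₃ : Literature.Analysis.Complex.KoebeQuarter) : oneArm_exponent :=
  oneArm_exponent_of_scalingLimit' h₁ (LawlerSchrammWerner2002_thm_1_2_of_hittingPDE h₃ h₂)

end Literature.Probability.Percolation
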